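import Summits.ValiantsHypothesis.ValiantsHypothesis.Theorems.PolyaContinuedLaplaceRigiditySingCodimPatterns

/-!
# `codim Sing(per₄) = 8` — the `3 × 4` step: a point of `P_{3,4}` has transcendence degree `≤ 8`

`P_{3,4}` is the variety of `3 × 4` matrices all of whose four maximal (`3 × 3`) sub-permanents
vanish (Boralevi–Carlini–Michałek–Ventura 2025, Def. 1.1; tree `BCMV25PermanentalVarieties`).
BCMV Prop. 3.10 (case `k = 3`) / Kirkup: `codim P_{3,4} = 4` — in print a Macaulay2 computation
(restriction to a circulant Hankel section).  This file PROVES the lower bound `codim ≥ 4` in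
generic-point currency and WITHOUT computer algebra:

* `trdeg_le_eight_threeByFour` — for rows `r u v : Fin 4 → L` over a field `L ⊇ F` (`2 ≠ 0`)
  with the four maximal sub-permanents of `[r; u; v]` vanishing, `trdeg_F F[r, u, v] ≤ 8`.

Proof.  Expanding along the row `r`, the hypotheses say `M(u,v) · r = 0` for the symmetric
zero-diagonal `4 × 4` matrix `M` whose off-diagonal entries are the six `2 × 2` permanents
`p_kl = u_k v_l + u_l v_k` (`M_{jj'} = p_{complement of {j,j'}}`).  Unconditionally
`Rel · r_j = 0` for `Rel = Q² − 4 p_ac p_bc p_ad p_bd`, `Q = p_ab p_cd − p_ac p_bd − p_ad p_bc`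
(`Rel = −det M`).  If `r_c = r_d = 0` at a pivot `p_cd ≠ 0` then `r = 0` (`trdeg ≤ 8` trivially);
otherwise `Rel(u,v) = 0` drops `trdeg F[u,v]` to `≤ 7` and `r_a, r_b` are solved from
`r_c, r_d`; then either `p_ad p_bd ≠ 0` / `p_ac p_bc ≠ 0` / `Q ≠ 0` solves one of `r_c, r_d` from
the other (`trdeg ≤ 7 + 1`), or the zero patterns `p_a• = 0` / `p_b• = 0` / `p_ad = p_bc = 0` /
`p_ac = p_bd = 0` drop `trdeg F[u,v]` to `≤ 6` (`trdeg ≤ 6 + 2`).  If all six `p_kl` vanish,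
`trdeg F[u,v] ≤ 4` (`trdeg ≤ 4 + 4`).  The zero-pattern covers are in
`…PolyaContinuedLaplaceRigiditySingCodimPatterns`, the bookkeeping in `…SingCodimTools`.

Helper for crux `CoverDecancellation` (stmt-ValiantsHypothesis-17819), line `laplace_rigidity`,
R3 row (`codim Sing(per₄) = 8`).  Honest framing: dictionary work on von zur Gathen's problem /
permanental varieties; VP ≠ VNP is NOT proved; no summit statement is touched.

## References
* A. Boralevi, E. Carlini, M. Michałek, E. Ventura, *On the codimension of permanental varieties*,
  Adv. Math. 461 (2025) 110079, arXiv:2402.17839, Prop. 3.10 and §3.1 (Kirkup).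
  [BoraleviCarliniMichalekVentura2025]
* J. Alper, T. Bogart, M. Velasco, Found. Comput. Math. 17 (2017), arXiv:1505.02205, §1
  ("codim(Sing(perm_4)) = 8", Macaulay2). [AlperBogartVelasco2017]
-/

set_option linter.dupNamespace false

noncomputable section

namespace Summit.ValiantsHypothesis.ValiantsHypothesis.Theorems.PolyaContinuedLaplaceRigidity.SingCodim

open MvPolynomial Cardinal
open Summit.ValiantsHypothesis.ValiantsHypothesis.Theorems.SymPencilPerFourHessianRankThreeZero (eq_or_of_four)

variable {F : Type*} [Field F] {L : Type*} [Field L] [Algebra F L]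

/-! ### The pivot case `p_cd ≠ 0` -/

/-- **The pivot case.**  Rows `r = (r_a, r_b, r_c, r_d)`, `u`, `v` of a `3 × 4` matrix whose four
maximal sub-permanents vanish (`Ea`–`Ed`, expanded along `r`), with the `2 × 2` permanent
`p_cd = u_c v_d + u_d v_c ≠ 0` (`2 ≠ 0`): the twelve entries have transcendence degree `≤ 8`.
[cite: BoraleviCarliniMichalekVentura2025, Prop. 3.10] -/
theorem trdeg_le_eight_of_pivot (h2 : (2 : L) ≠ 0) (ra rb rc rd ua ub uc ud va vb vc vd : L)
    (hcd : uc * vd + ud * vc ≠ 0)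
    (Ea : rb * (uc * vd + ud * vc) + rc * (ub * vd + ud * vb) + rd * (ub * vc + uc * vb) = 0)
    (Eb : ra * (uc * vd + ud * vc) + rc * (ua * vd + ud * va) + rd * (ua * vc + uc * va) = 0)
    (Ec : ra * (ub * vd + ud * vb) + rb * (ua * vd + ud * va) + rd * (ua * vb + ub * va) = 0)
    (Ed : ra * (ub * vc + uc * vb) + rb * (ua * vc + uc * va) + rc * (ua * vb + ub * va) = 0) :
    Algebra.trdeg F (Algebra.adjoin F
      ({ra, rb, rc, rd, ua, ub, uc, ud, va, vb, vc, vd} : Set L)) ≤ 8 := by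
  -- the `2 × 4` block as an `8`-tuple, and the set `U` of its entries
  set w : Fin 8 → L := ![ua, ub, uc, ud, va, vb, vc, vd] with hw
  have hUa : ua ∈ Set.range w := ⟨0, rfl⟩
  have hUb : ub ∈ Set.range w := ⟨1, rfl⟩
  have hUc : uc ∈ Set.range w := ⟨2, rfl⟩
  have hUd : ud ∈ Set.range w := ⟨3, rfl⟩
  have hVa : va ∈ Set.range w := ⟨4, rfl⟩
  have hVb : vb ∈ Set.range w := ⟨5, rfl⟩
  have hVc : vc ∈ Set.range w := ⟨6, rfl⟩
  have hVd : vd ∈ Set.range w := ⟨7, rfl⟩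
  -- the six `2 × 2` permanents and `Q`
  set pab := ua * vb + ub * va with hpab
  set pac := ua * vc + uc * va with hpac
  set pad := ua * vd + ud * va with hpad
  set pbc := ub * vc + uc * vb with hpbc
  set pbd := ub * vd + ud * vb with hpbd
  set pcd := uc * vd + ud * vc with hpcd
  set Q := pab * pcd - pac * pbd - pad * pbc with hQ
  -- membership of the `p`'s and `Q` in any `F[T]`, `T ⊇ U`
  have memT : ∀ {T : Set L}, Set.range w ⊆ T →
      pab ∈ Algebra.adjoin F T ∧ pac ∈ Algebra.adjoin F T ∧ pad ∈ Algebra.adjoin F T ∧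
      pbc ∈ Algebra.adjoin F T ∧ pbd ∈ Algebra.adjoin F T ∧ pcd ∈ Algebra.adjoin F T := by
    intro T hT
    have m : ∀ {x : L}, x ∈ Set.range w → x ∈ Algebra.adjoin F T := fun hx => mem_adjoin_of_mem (hT hx)
    exact ⟨add_mem (mul_mem (m hUa) (m hVb)) (mul_mem (m hUb) (m hVa)),
      add_mem (mul_mem (m hUa) (m hVc)) (mul_mem (m hUc) (m hVa)),
      add_mem (mul_mem (m hUa) (m hVd)) (mul_mem (m hUd) (m hVa)),
      add_mem (mul_mem (m hUb) (m hVc)) (mul_mem (m hUc) (m hVb)),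
      add_mem (mul_mem (m hUb) (m hVd)) (mul_mem (m hUd) (m hVb)),
      add_mem (mul_mem (m hUc) (m hVd)) (mul_mem (m hUd) (m hVc))⟩
  -- the two derived equations and `Rel · r_c = Rel · r_d = 0`
  have E3 : -(2 * (pad * pbd)) * rc + Q * rd = 0 := by
    linear_combination pcd * Ec - pbd * Eb - pad * Ea
  have E4 : Q * rc - 2 * (pac * pbc) * rd = 0 := by
    linear_combination pcd * Ed - pbc * Eb - pac * Ea
  have hRc : (Q ^ 2 - 4 * (pac * pbc * (pad * pbd))) * rc = 0 := by
    linear_combination (2 * (pac * pbc)) * E3 + Q * E4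
  have hRd : (Q ^ 2 - 4 * (pac * pbc * (pad * pbd))) * rd = 0 := by
    linear_combination (2 * (pad * pbd)) * E4 + Q * E3
  -- `r_a`, `r_b` are solved from `r_c`, `r_d` (pivot `p_cd`)
  have solve_ab : ∀ {T : Set L}, Set.range w ⊆ T → rc ∈ Algebra.adjoin F T →
      rd ∈ Algebra.adjoin F T →
      IsAlgebraic (Algebra.adjoin F T) ra ∧ IsAlgebraic (Algebra.adjoin F T) rb := by
    intro T hT hc hd
    obtain ⟨-, mac, mad, mbc, mbd, mcd⟩ := memT hT
    refine ⟨alg_of_mul_eq (c := pcd) (d := -(rc * pad + rd * pac)) mcd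
        (neg_mem (add_mem (mul_mem hc mad) (mul_mem hd mac))) hcd ?_,
      alg_of_mul_eq (c := pcd) (d := -(rc * pbd + rd * pbc)) mcd
        (neg_mem (add_mem (mul_mem hc mbd) (mul_mem hd mbc))) hcd ?_⟩
    · linear_combination Eb
    · linear_combination Ea
  -- Case 1: `r_c = r_d = 0`, hence `r = 0`
  by_cases hr0 : rc = 0 ∧ rd = 0
  · obtain ⟨hc0, hd0⟩ := hr0
    have ha0 : ra = 0 := by
      have h : ra * pcd = 0 := by
        have := Eb; rw [hc0, hd0, zero_mul, zero_mul, add_zero, add_zero] at this; exact this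
      exact (mul_eq_zero.mp h).resolve_right hcd
    have hb0 : rb = 0 := by
      have h : rb * pcd = 0 := by
        have := Ea; rw [hc0, hd0, zero_mul, zero_mul, add_zero, add_zero] at this; exact this
      exact (mul_eq_zero.mp h).resolve_right hcd
    refine trdeg_adjoin_le_of_cover w fun e he => ?_
    simp only [Set.mem_insert_iff, Set.mem_singleton_iff] at he
    rcases he with rfl | rfl | rfl | rfl | rfl | rfl | rfl | rfl | rfl | rfl | rfl | rfl
    · exact alg_of_eq_zero _ ha0
    · exact alg_of_eq_zero _ hb0
    · exact alg_of_eq_zero _ hc0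
    · exact alg_of_eq_zero _ hd0
    · exact alg_of_mem hUa
    · exact alg_of_mem hUb
    · exact alg_of_mem hUc
    · exact alg_of_mem hUd
    · exact alg_of_mem hVa
    · exact alg_of_mem hVb
    · exact alg_of_mem hVc
    · exact alg_of_mem hVd
  -- Case 2: `r_c ≠ 0` or `r_d ≠ 0`; then `Rel(u,v) = 0` and `trdeg F[u,v] ≤ 7`
  have hRel : Q ^ 2 - 4 * (pac * pbc * (pad * pbd)) = 0 := by
    rcases not_and_or.mp hr0 with hc | hd
    · exact (mul_eq_zero.mp hRc).resolve_right hc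
    · exact (mul_eq_zero.mp hRd).resolve_right hd
  have hU7 : Algebra.trdeg F (Algebra.adjoin F (Set.range w)) ≤ 7 := by
    refine trdeg_adjoin_range_le_of_aeval_eq_zero w
      (P := ((X 0 * X 5 + X 1 * X 4) * (X 2 * X 7 + X 3 * X 6) -
              (X 0 * X 6 + X 2 * X 4) * (X 1 * X 7 + X 3 * X 5) -
              (X 0 * X 7 + X 3 * X 4) * (X 1 * X 6 + X 2 * X 5)) ^ 2 -
            4 * ((X 0 * X 6 + X 2 * X 4) * (X 1 * X 6 + X 2 * X 5) *
              ((X 0 * X 7 + X 3 * X 4) * (X 1 * X 7 + X 3 * X 5)))) ?_ ?_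
    · -- non-zero: value `-4` at `u = (0,1,1,1)`, `v = (1,0,1,1)`
      intro h0
      have h := congrArg (MvPolynomial.eval (![0, 1, 1, 1, 1, 0, 1, 1] : Fin 8 → F)) h0
      simp only [map_sub, map_mul, map_pow, map_add, map_ofNat, MvPolynomial.eval_X,
        map_zero] at h
      simp only [Matrix.cons_val_zero, Matrix.cons_val_one, Matrix.cons_val] at h
      norm_num at h
      -- `h : (4 : F) = 0`
      have h4 : (4 : L) = 0 := by
        have := congrArg (algebraMap F L) h
        rwa [map_ofNat, map_zero] at this
      have h22 : (2 : L) * 2 = 0 := by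
        calc (2 : L) * 2 = 4 := by norm_num
          _ = 0 := h4
      exact (mul_ne_zero h2 h2) h22
    · simp only [map_sub, map_mul, map_pow, map_add, map_ofNat, MvPolynomial.aeval_X, hw]
      simp only [Matrix.cons_val_zero, Matrix.cons_val_one, Matrix.cons_val]
      linear_combination hRel
  -- the four sub-cases
  by_cases hA : pad * pbd ≠ 0
  · -- `r_c` solved from `r_d`; cover `U ∪ {r_d}`
    have hT : Set.range w ⊆ Set.range w ∪ Set.range ![rd] := Set.subset_union_left
    have hd : rd ∈ Algebra.adjoin F (Set.range w ∪ Set.range ![rd]) :=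
      mem_adjoin_of_mem (Or.inr ⟨0, rfl⟩)
    obtain ⟨mab, mac, mad, mbc, mbd, mcd⟩ := memT hT
    have hQm : Q ∈ Algebra.adjoin F (Set.range w ∪ Set.range ![rd]) :=
      sub_mem (sub_mem (mul_mem mab mcd) (mul_mem mac mbd)) (mul_mem mad mbc)
    have hc : IsAlgebraic (Algebra.adjoin F (Set.range w ∪ Set.range ![rd])) rc :=
      alg_of_mul_eq (c := -(2 * (pad * pbd))) (d := -(Q * rd))
        (neg_mem (mul_mem (ofNat_mem _ 2) (mul_mem mad mbd)))
        (neg_mem (mul_mem hQm hd)) (neg_ne_zero.mpr (mul_ne_zero h2 hA)) (by linear_combination E3)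
    -- everything is algebraic over `F[U ∪ {r_c, r_d}]`, and `r_c` over `F[U ∪ {r_d}]`
    have hT' : Set.range w ⊆ Set.range w ∪ {rc, rd} := Set.subset_union_left
    obtain ⟨haa, hbb⟩ := solve_ab hT' (mem_adjoin_of_mem (Or.inr (by simp)))
      (mem_adjoin_of_mem (Or.inr (by simp)))
    have down : ∀ y ∈ Set.range w ∪ {rc, rd},
        IsAlgebraic (Algebra.adjoin F (Set.range w ∪ Set.range ![rd])) y := by
      rintro y (hy | hy)
      · exact alg_of_mem (Or.inl hy)
      · simp only [Set.mem_insert_iff, Set.mem_singleton_iff] at hy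
        rcases hy with rfl | rfl
        · exact hc
        · exact alg_of_mem (Or.inr ⟨0, rfl⟩)
    refine le_trans (trdeg_adjoin_le_of_cover_add hU7 ![rd] fun e he => ?_) (by norm_num)
    simp only [Set.mem_insert_iff, Set.mem_singleton_iff] at he
    rcases he with rfl | rfl | rfl | rfl | rfl | rfl | rfl | rfl | rfl | rfl | rfl | rfl
    · exact alg_trans haa down
    · exact alg_trans hbb down
    · exact hc
    · exact alg_of_mem (Or.inr ⟨0, rfl⟩)
    · exact alg_of_mem (Or.inl hUa)
    · exact alg_of_mem (Or.inl hUb)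
    · exact alg_of_mem (Or.inl hUc)
    · exact alg_of_mem (Or.inl hUd)
    · exact alg_of_mem (Or.inl hVa)
    · exact alg_of_mem (Or.inl hVb)
    · exact alg_of_mem (Or.inl hVc)
    · exact alg_of_mem (Or.inl hVd)
  by_cases hB : pac * pbc ≠ 0
  · -- `r_d` solved from `r_c`; cover `U ∪ {r_c}`
    have hT : Set.range w ⊆ Set.range w ∪ Set.range ![rc] := Set.subset_union_left
    have hc : rc ∈ Algebra.adjoin F (Set.range w ∪ Set.range ![rc]) :=
      mem_adjoin_of_mem (Or.inr ⟨0, rfl⟩)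
    obtain ⟨mab, mac, mad, mbc, mbd, mcd⟩ := memT hT
    have hQm : Q ∈ Algebra.adjoin F (Set.range w ∪ Set.range ![rc]) :=
      sub_mem (sub_mem (mul_mem mab mcd) (mul_mem mac mbd)) (mul_mem mad mbc)
    have hd : IsAlgebraic (Algebra.adjoin F (Set.range w ∪ Set.range ![rc])) rd :=
      alg_of_mul_eq (c := -(2 * (pac * pbc))) (d := -(Q * rc))
        (neg_mem (mul_mem (ofNat_mem _ 2) (mul_mem mac mbc)))
        (neg_mem (mul_mem hQm hc)) (neg_ne_zero.mpr (mul_ne_zero h2 hB)) (by linear_combination E4)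
    have hT' : Set.range w ⊆ Set.range w ∪ {rc, rd} := Set.subset_union_left
    obtain ⟨haa, hbb⟩ := solve_ab hT' (mem_adjoin_of_mem (Or.inr (by simp)))
      (mem_adjoin_of_mem (Or.inr (by simp)))
    have down : ∀ y ∈ Set.range w ∪ {rc, rd},
        IsAlgebraic (Algebra.adjoin F (Set.range w ∪ Set.range ![rc])) y := by
      rintro y (hy | hy)
      · exact alg_of_mem (Or.inl hy)
      · simp only [Set.mem_insert_iff, Set.mem_singleton_iff] at hy
        rcases hy with rfl | rfl
        · exact alg_of_mem (Or.inr ⟨0, rfl⟩)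
        · exact hd
    refine le_trans (trdeg_adjoin_le_of_cover_add hU7 ![rc] fun e he => ?_) (by norm_num)
    simp only [Set.mem_insert_iff, Set.mem_singleton_iff] at he
    rcases he with rfl | rfl | rfl | rfl | rfl | rfl | rfl | rfl | rfl | rfl | rfl | rfl
    · exact alg_trans haa down
    · exact alg_trans hbb down
    · exact alg_of_mem (Or.inr ⟨0, rfl⟩)
    · exact hd
    · exact alg_of_mem (Or.inl hUa)
    · exact alg_of_mem (Or.inl hUb)
    · exact alg_of_mem (Or.inl hUc)
    · exact alg_of_mem (Or.inl hUd)
    · exact alg_of_mem (Or.inl hVa)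
    · exact alg_of_mem (Or.inl hVb)
    · exact alg_of_mem (Or.inl hVc)
    · exact alg_of_mem (Or.inl hVd)
  push Not at hA hB
  by_cases hQ0 : Q ≠ 0
  · -- then `r_c = r_d = 0`, excluded
    exfalso
    have hd0 : rd = 0 := by
      have h : Q * rd = 0 := by
        have := E3; rw [hA, mul_zero, neg_zero, zero_mul, zero_add] at this; exact this
      exact (mul_eq_zero.mp h).resolve_left hQ0
    have hc0 : rc = 0 := by
      have h : Q * rc = 0 := by
        have := E4; rw [hB, mul_zero, zero_mul, sub_zero] at this; exact this
      exact (mul_eq_zero.mp h).resolve_left hQ0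
    exact hr0 ⟨hc0, hd0⟩
  push Not at hQ0
  -- the zero patterns: `trdeg F[u,v] ≤ 6`
  have hU6 : Algebra.trdeg F (Algebra.adjoin F (Set.range w)) ≤ 6 := by
    -- membership of the entries of `w` in the eight-element set, by index
    have hwmem : ∀ e ∈ Set.range w, e ∈ ({ua, ub, uc, ud, va, vb, vc, vd} : Set L) := by
      rintro e ⟨i, rfl⟩
      fin_cases i <;> simp [hw]
    have hwmem' : ∀ e ∈ Set.range w, e ∈ ({ub, ua, uc, ud, vb, va, vc, vd} : Set L) := by
      rintro e ⟨i, rfl⟩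
      fin_cases i <;> simp [hw]
    rcases mul_eq_zero.mp hA with had0 | hbd0 <;> rcases mul_eq_zero.mp hB with hac0 | hbc0
    · -- `p_ad = p_ac = 0`, hence `p_ab = 0`: star at `a`
      have hab0 : pab = 0 := by
        have h : pab * pcd = 0 := by
          have := hQ0; rw [hQ, had0, hac0, zero_mul, zero_mul, sub_zero, sub_zero] at this
          exact this
        exact (mul_eq_zero.mp h).resolve_right hcd
      obtain ⟨f, hf⟩ := cover_of_perm_two_star (F := F) ua ub uc ud va vb vc vd hab0 hac0 had0
      exact trdeg_adjoin_le_of_cover f fun e he => hf e (hwmem e he)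
    · -- `p_ad = p_bc = 0`: two disjoint pairs
      obtain ⟨f, hf⟩ := cover_of_perm_two_eq_zero (F := F) ua ud va vd had0
      obtain ⟨g, hg⟩ := cover_of_perm_two_eq_zero (F := F) ub uc vb vc hbc0
      refine le_trans (trdeg_adjoin_le_of_cover_two f g fun e he => ?_) (by norm_num)
      rcases he with ⟨i, rfl⟩
      fin_cases i
      · exact alg_mono Set.subset_union_left (hf ua (by simp))
      · exact alg_mono Set.subset_union_right (hg ub (by simp))
      · exact alg_mono Set.subset_union_right (hg uc (by simp))
      · exact alg_mono Set.subset_union_left (hf ud (by simp))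
      · exact alg_mono Set.subset_union_left (hf va (by simp))
      · exact alg_mono Set.subset_union_right (hg vb (by simp))
      · exact alg_mono Set.subset_union_right (hg vc (by simp))
      · exact alg_mono Set.subset_union_left (hf vd (by simp))
    · -- `p_bd = p_ac = 0`: two disjoint pairs
      obtain ⟨f, hf⟩ := cover_of_perm_two_eq_zero (F := F) ub ud vb vd hbd0
      obtain ⟨g, hg⟩ := cover_of_perm_two_eq_zero (F := F) ua uc va vc hac0
      refine le_trans (trdeg_adjoin_le_of_cover_two f g fun e he => ?_) (by norm_num)
      rcases he with ⟨i, rfl⟩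
      fin_cases i
      · exact alg_mono Set.subset_union_right (hg ua (by simp))
      · exact alg_mono Set.subset_union_left (hf ub (by simp))
      · exact alg_mono Set.subset_union_right (hg uc (by simp))
      · exact alg_mono Set.subset_union_left (hf ud (by simp))
      · exact alg_mono Set.subset_union_right (hg va (by simp))
      · exact alg_mono Set.subset_union_left (hf vb (by simp))
      · exact alg_mono Set.subset_union_right (hg vc (by simp))
      · exact alg_mono Set.subset_union_left (hf vd (by simp))
    · -- `p_bd = p_bc = 0`, hence `p_ab = 0`: star at `b`
      have hab0 : pab = 0 := by
        have h : pab * pcd = 0 := by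
          have := hQ0; rw [hQ, hbd0, hbc0, mul_zero, mul_zero, sub_zero, sub_zero] at this
          exact this
        exact (mul_eq_zero.mp h).resolve_right hcd
      have hba0 : ub * va + ua * vb = 0 := by linear_combination hab0
      obtain ⟨f, hf⟩ := cover_of_perm_two_star (F := F) ub ua uc ud vb va vc vd hba0 hbc0 hbd0
      exact trdeg_adjoin_le_of_cover f fun e he => hf e (hwmem' e he)
  -- cover `U ∪ {r_c, r_d}`
  have hT' : Set.range w ⊆ Set.range w ∪ Set.range ![rc, rd] := Set.subset_union_left
  obtain ⟨haa, hbb⟩ := solve_ab hT' (mem_adjoin_of_mem (Or.inr ⟨0, rfl⟩))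
    (mem_adjoin_of_mem (Or.inr ⟨1, rfl⟩))
  refine le_trans (trdeg_adjoin_le_of_cover_add hU6 ![rc, rd] fun e he => ?_) (by norm_num)
  simp only [Set.mem_insert_iff, Set.mem_singleton_iff] at he
  rcases he with rfl | rfl | rfl | rfl | rfl | rfl | rfl | rfl | rfl | rfl | rfl | rfl
  · exact haa
  · exact hbb
  · exact alg_of_mem (Or.inr ⟨0, rfl⟩)
  · exact alg_of_mem (Or.inr ⟨1, rfl⟩)
  · exact alg_of_mem (Or.inl hUa)
  · exact alg_of_mem (Or.inl hUb)
  · exact alg_of_mem (Or.inl hUc)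
  · exact alg_of_mem (Or.inl hUd)
  · exact alg_of_mem (Or.inl hVa)
  · exact alg_of_mem (Or.inl hVb)
  · exact alg_of_mem (Or.inl hVc)
  · exact alg_of_mem (Or.inl hVd)

/-! ### The `3 × 4` step -/

/-- **`codim P_{3,4} ≥ 4` at a point.**  If the four maximal sub-permanents of the `3 × 4` matrix
with rows `r, u, v` (over a field `L ⊇ F`, `2 ≠ 0`) vanish — written out, for every three distinct
columns `b, c, d`, `r_b p_cd + r_c p_bd + r_d p_bc = 0` with `p_kl = u_k v_l + u_l v_k` — then
`trdeg_F F[r, u, v] ≤ 8`.  With BCMV Prop. 3.1's upper bound this is `codim P_{3,4} = 4`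
(BCMV Prop. 3.10 for `k = 3`, Kirkup), here without Macaulay2.
[cite: BoraleviCarliniMichalekVentura2025, Prop. 3.10] -/
theorem trdeg_le_eight_threeByFour (h2 : (2 : L) ≠ 0) (r u v : Fin 4 → L)
    (hE : ∀ b c d : Fin 4, b ≠ c → b ≠ d → c ≠ d →
      r b * (u c * v d + u d * v c) + r c * (u b * v d + u d * v b) +
        r d * (u b * v c + u c * v b) = 0) :
    Algebra.trdeg F (Algebra.adjoin F (Set.range r ∪ Set.range u ∪ Set.range v)) ≤ 8 := by
  by_cases hall : ∀ c d : Fin 4, c ≠ d → u c * v d + u d * v c = 0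
  · -- all six `2 × 2` permanents vanish: `trdeg F[u,v] ≤ 4`, plus the four entries of `r`
    obtain ⟨f, hf⟩ := cover_of_perm_two_all (F := F) h2 u v hall
    refine le_trans (trdeg_adjoin_le_of_cover_two f r fun e he => ?_) (by norm_num)
    rcases he with (he | he) | he
    · exact alg_of_mem (Or.inr he)
    · exact alg_mono Set.subset_union_left (hf e (Or.inl he))
    · exact alg_mono Set.subset_union_left (hf e (Or.inr he))
  · push Not at hall
    obtain ⟨c, d, hcd, hp⟩ := hall
    obtain ⟨a, b, hab, hac, had, hbc, hbd⟩ := exists_two_others c d hcd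
    have key := trdeg_le_eight_of_pivot (F := F) h2 (r a) (r b) (r c) (r d) (u a) (u b) (u c) (u d)
      (v a) (v b) (v c) (v d) hp (hE b c d hbc hbd hcd) (hE a c d hac had hcd)
      (hE a b d hab had hbd) (hE a b c hab hac hbc)
    refine le_trans (trdeg_adjoin_le_trdeg_of_forall_alg fun e he => alg_of_mem ?_) key
    rcases he with (⟨i, rfl⟩ | ⟨i, rfl⟩) | ⟨i, rfl⟩ <;>
      rcases eq_or_of_four a b c d hab hac had hbc hbd hcd i with rfl | rfl | rfl | rfl <;>
      simp

end Summit.ValiantsHypothesis.ValiantsHypothesis.Theorems.PolyaContinuedLaplaceRigidity.SingCodim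

end
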